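import Summits.KontsevichZagierPeriods.Zeta5Search.WedgeDictionaryQPart
import Summits.KontsevichZagierPeriods.Zeta5Search.WedgeDictionaryForms
import Summits.KontsevichZagierPeriods.Zeta5Search.Certificates.DualSeriesTermBounds
import HarnessLib

/-!
# ζ(5) search — certificates: the forms of the census T1-map ray g8 #4 (H1) BY NAME (cell `pub-zeta5`, P1 g11)

HONEST FRAMING: systematic search; no irrationality claim unless certified.

OUR work (Summit side; port of certifier 2's `Certificates/RecordRayForms.lean` from Brown–Zudilin's record ray to the
census's top T1-map class g8 #4 (H1)). The ray is `a·n`, `a = (7,13,9,12,11,15,17,12)` (census g8/g22 class #1; a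
CONVERGENT vector of [BrownZudilin2022, (3)]), with dual parameters `b = b(a·n) = n·(34; 14,13,12,11,10,9,8)`,
`d = 25n`, partner `b′ = b + e₇`. This file fixes, WITHOUT any conjecture, the objects every later certificate of this
ray refers to:

* `h1Q n = Q(a·n) ∈ ℤ` — the printed leading coefficient (17) (`BrownZudilin2022.QOf`);
* `h1P n = ρ(a·n)·(W(b′)V(b) − W(b)V(b′)) ∈ ℚ` — the wedge-dictionary companion (`rhoOf`, `coeffW`, `coeffV`);
* `h1Form n = ρ(a·n)·(W(b′)·F̃₇(b) − W(b)·F̃₇(b′)) ∈ ℝ` — the `ζ(3)`-free combination of two contiguous very-well-poised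
  series (34) (`vwpDual 7`); the slots as naturals `BH1E e n` (`e` = shift of the seventh slot: `e = 0` is `b`,
  `e = 1` is `b′`) in certifier 2's `natB` format, so that the generic dual-series layer
  (`Certificates/DualSeriesTermBounds`) applies verbatim;

and PROVES, for every `n ≥ 1`, `h1Q_eq_wedge : Q(a·n) = ρ(a·n)·(U(b)W(b′) − U(b′)W(b))` (the Q-part of the wedge
dictionary, tree THEOREM `WedgeDictionary.wedgeDictionary_Q`, its side conditions decided here) and
`h1Form_eq : h1Form n = h1Q n · ζ(5) − h1P n` (`WedgeDictionary.zeta3_elimination`). Nothing here is a rate, a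
denominator, or a statement about `ζ(5)`.
-/

noncomputable section

open Finset

namespace Summit.KontsevichZagierPeriods.Zeta5Search.RayH1

open Summit.KontsevichZagierPeriods.Zeta5Search.DualSeries
open Summit.KontsevichZagierPeriods.Zeta5Search.DualSeriesBounds (natB natB_zero natB_succ inBox_natB)
open Summit.KontsevichZagierPeriods.Zeta5Search.WedgeDictionary
open Literature.NumberTheory.Irrationality.BrownZudilin2022 (bOfA Converges QOf vwpDual convergenceForms)
open Literature.NumberTheory.Transcendental (zetaValue)

/-! ### The objects -/

/-- The census g8 class-#4 vector `a = (7,13,9,12,11,15,17,12)`. -/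
def h1Vec : Fin 8 → ℤ := ![7, 13, 9, 12, 11, 15, 17, 12]

/-- The scaled parameters `a·n`. -/
def aH1 (n : ℕ) : Fin 8 → ℤ := fun i => (n : ℤ) * h1Vec i

/-- The dual slots `β = (14,13,12,11,10,9,8)` (index `j` for `β_{j+1}`; `0` beyond). -/
def βH1 (j : ℕ) : ℕ :=
  if j = 0 then 14 else if j = 1 then 13 else if j = 2 then 12 else if j = 3 then 11
  else if j = 4 then 10 else if j = 5 then 9 else if j = 6 then 8 else 0

/-- The natural slots of `b` (`e = 0`) and of the partner `b′ = b + e₇` (`e = 1`): `B_j = β_{j+1}·n + [j = 6]·e`. -/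
def BH1E (e n : ℕ) : ℕ → ℕ := fun j => βH1 j * n + if j = 6 then e else 0

/-- `b = b(a·n) = n·(34; 14,13,12,11,10,9,8)` as an integer vector. -/
def bH1 (n : ℕ) : ℕ → ℤ := natB (34 * n) (BH1E 0 n)

/-- The partner `b′ = b + e₇`. -/
def bH1' (n : ℕ) : ℕ → ℤ := natB (34 * n) (BH1E 1 n)

/-- `Q_n = Q(a·n)`, Brown–Zudilin's leading coefficient (17) on the ray (an integer). -/
def h1Q (n : ℕ) : ℤ := QOf (aH1 n)

/-- `P_n = ρ(a·n)·(W(b′)V(b) − W(b)V(b′))`, the rational companion of `Q_n` given by the wedge dictionary. -/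
def h1P (n : ℕ) : ℚ :=
  rhoOf (aH1 n) * (coeffW (bH1' n) * coeffV (bH1 n) - coeffW (bH1 n) * coeffV (bH1' n))

/-- The approximating form `L_n = ρ(a·n)·(W(b′)·F̃₇(b) − W(b)·F̃₇(b′))` of the ray. -/
def h1Form (n : ℕ) : ℝ :=
  (rhoOf (aH1 n) : ℝ) *
    ((coeffW (bH1' n) : ℝ) * vwpDual 7 (bH1 n) - (coeffW (bH1 n) : ℝ) * vwpDual 7 (bH1' n))

/-! ### Slot bookkeeping -/

/-- The values of `βH1`. -/
theorem βH1_values : βH1 0 = 14 ∧ βH1 1 = 13 ∧ βH1 2 = 12 ∧ βH1 3 = 11 ∧ βH1 4 = 10 ∧ βH1 5 = 9 ∧ βH1 6 = 8 := by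
  simp [βH1]

/-- Every slot is at most `14`. -/
theorem βH1_le (j : ℕ) : βH1 j ≤ 14 := by
  unfold βH1; split_ifs <;> omega

/-- Every slot `j < 7` is at least `8`. -/
theorem βH1_ge {j : ℕ} (hj : j < 7) : 8 ≤ βH1 j := by
  unfold βH1; split_ifs <;> omega

/-- `Σ_{j<7} β_{j+1} = 77`. -/
theorem sum_βH1 : ∑ j ∈ range 7, βH1 j = 77 := by
  simp [sum_range_succ, βH1]

/-- `bH1 n 0 = 34n`. -/
theorem bH1_zero (n : ℕ) : bH1 n 0 = 34 * n := by simp [bH1, natB]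

/-- The slots of `bH1 n`: `bH1 n (j+1) = β_{j+1}·n` for `j < 7`. -/
theorem bH1_succ (n : ℕ) {j : ℕ} (hj : j ∈ range 7) : bH1 n (j + 1) = (βH1 j * n : ℕ) := by
  have hj' := mem_range.1 hj
  simp [bH1, natB_succ _ _ hj, BH1E]

/-- `b(a·n) = bH1 n`. -/
theorem bOfA_aH1 (n : ℕ) : bOfA (aH1 n) = bH1 n := by
  funext j
  rcases j with _ | _ | _ | _ | _ | _ | _ | _ | k
  all_goals simp [bOfA, aH1, h1Vec, bH1, natB, BH1E, βH1]
  all_goals ring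

/-- `bH1' n = bH1 n + e₇`. -/
theorem bH1'_eq_update (n : ℕ) : bH1' n = Function.update (bH1 n) 7 (bH1 n 7 + 1) := by
  funext j
  by_cases hj : j = 7
  · subst hj
    simp [Function.update, bH1, bH1', natB, BH1E, βH1]
  · rw [Function.update_of_ne hj]
    unfold bH1 bH1' natB BH1E
    have h6 : j - 1 ≠ 6 ∨ j = 0 := by omega
    rcases h6 with h6 | h0
    · simp [h6]
    · subst h0; simp

/-- The box conditions of the natural slots: `B_j ≤ 34n` (`e ≤ 1`, `n ≥ 1`). -/
theorem hle_h1E {e n : ℕ} (he : e ≤ 1) (hn : 1 ≤ n) : ∀ j ∈ range 7, BH1E e n j ≤ 34 * n := by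
  intro j hj
  unfold BH1E
  have := βH1_le j
  split_ifs <;> nlinarith

/-- The region conditions `2B_j ≤ 34n + 1` (`e ≤ 1`, `n ≥ 1`). -/
theorem hreg_h1E {e n : ℕ} (he : e ≤ 1) (hn : 1 ≤ n) : ∀ j ∈ range 7, 2 * BH1E e n j ≤ 34 * n + 1 := by
  intro j hj
  unfold BH1E
  have := βH1_le j
  split_ifs <;> nlinarith

/-- The summability condition `Σ_j B_j ≤ 3·34n + 1` (`e ≤ 1`). -/
theorem hsum_h1E {e n : ℕ} (he : e ≤ 1) : ∑ j ∈ range 7, BH1E e n j ≤ 3 * (34 * n) + 1 := by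
  have h : ∑ j ∈ range 7, BH1E e n j = 77 * n + e := by
    simp [sum_range_succ, BH1E, βH1]; ring
  rw [h]; omega

/-! ### Side conditions on the ray -/

/-- The parameters `a·n` converge for every `n` (all seventeen forms (3) are non-negative multiples of `n`). -/
theorem converges_aH1 (n : ℕ) : Converges (aH1 n) := by
  intro x hx
  simp only [convergenceForms, aH1, h1Vec, List.mem_cons, List.not_mem_nil, or_false,
    Matrix.cons_val_zero, Matrix.cons_val_one, Matrix.cons_val] at hx
  omega

/-- The region of the wedge dictionary: `0 ≤ b_i` and `2b_i ≤ b₀ + 1` for `i = 1,…,7`. -/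
theorem region_aH1 (n : ℕ) : ∀ i ∈ Icc 1 7, 0 ≤ bOfA (aH1 n) i ∧ 2 * bOfA (aH1 n) i ≤ bOfA (aH1 n) 0 + 1 := by
  intro i hi
  obtain ⟨j, rfl⟩ : ∃ j, i = j + 1 := ⟨i - 1, by have := (mem_Icc.1 hi).1; omega⟩
  have hj : j ∈ range 7 := by have := (mem_Icc.1 hi).2; exact mem_range.2 (by omega)
  rw [bOfA_aH1, bH1_zero, bH1_succ n hj]
  have := βH1_le j
  constructor
  · positivity
  · push_cast; nlinarith [(Nat.cast_nonneg n : (0 : ℤ) ≤ n), (by exact_mod_cast this : (βH1 j : ℤ) ≤ 14)]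

/-- `d(b(a·n)) = 25n`. -/
theorem dOf_aH1 (n : ℕ) : dOf (bOfA (aH1 n)) = 25 * n := by
  rw [dOf_bOfA]
  simp [aH1, h1Vec]
  ring

/-- The box of `DualSeries` holds on the ray. -/
theorem inBox_bH1 (n : ℕ) : InBox (bH1 n) := by
  refine ⟨by rw [bH1_zero]; positivity, fun j hj => ?_⟩
  rw [bH1_zero, bH1_succ n hj]
  have := βH1_le j
  constructor
  · positivity
  · push_cast; nlinarith [(Nat.cast_nonneg n : (0 : ℤ) ≤ n), (by exact_mod_cast this : (βH1 j : ℤ) ≤ 14)]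

/-- The partner `j = 7` is admissible for `n ≥ 1`: `2(b₇ + 1) ≤ b₀ + 1`. -/
theorem partner_aH1 {n : ℕ} (hn : 1 ≤ n) : 2 * (bOfA (aH1 n) 7 + 1) ≤ bOfA (aH1 n) 0 + 1 := by
  rw [bOfA_aH1, bH1_zero, bH1_succ n (by simp)]
  simp only [βH1]
  push_cast
  have : (1 : ℤ) ≤ n := by exact_mod_cast hn
  nlinarith

/-! ### The two identities -/

/-- **Q-part of the wedge dictionary on the ray**: for `n ≥ 1`,
`Q(a·n) = ρ(a·n)·(U(b)W(b′) − U(b′)W(b))` with `b = bH1 n`, `b′ = b + e₇`. -/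
theorem h1Q_eq_wedge {n : ℕ} (hn : 1 ≤ n) :
    (h1Q n : ℚ) = rhoOf (aH1 n) *
      (coeffU (bH1 n) * coeffW (bH1' n) - coeffU (bH1' n) * coeffW (bH1 n)) := by
  have h := wedgeDictionary_Q (aH1 n) 7 (by simp) (converges_aH1 n) (region_aH1 n)
    (by rw [dOf_aH1]; positivity) (partner_aH1 hn)
  rw [bH1'_eq_update]
  simpa only [h1Q, bOfA_aH1] using h

/-- **The ray's forms are `Q(a·n)ζ(5) − P_n`**: for `n ≥ 1`,
`ρ(a·n)·(W(b′)F̃₇(b) − W(b)F̃₇(b′)) = Q(a·n)·ζ(5) − P_n` (ζ(3)-elimination + the Q-part of the dictionary). -/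
theorem h1Form_eq {n : ℕ} (hn : 1 ≤ n) :
    h1Form n = (h1Q n : ℝ) * zetaValue 5 - (h1P n : ℝ) := by
  have hd : 0 ≤ dOf (bH1 n) := by rw [← bOfA_aH1, dOf_aH1]; positivity
  have hle : bH1 n 7 ≤ bH1 n 0 := by
    rw [bH1_zero, bH1_succ n (by simp)]; simp only [βH1]; push_cast; nlinarith
  have h3 := zeta3_elimination (bH1 n) (inBox_bH1 n) hd (j := 7) (by simp) hle
  have hQ : ((h1Q n : ℚ) : ℝ) = ((rhoOf (aH1 n) *
      (coeffU (bH1 n) * coeffW (bH1' n) - coeffU (bH1' n) * coeffW (bH1 n)) : ℚ) : ℝ) := by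
    rw [h1Q_eq_wedge hn]
  unfold h1Form h1P
  rw [show ((h1Q n : ℤ) : ℝ) = ((h1Q n : ℚ) : ℝ) by norm_cast, hQ]
  rw [bH1'_eq_update] at *
  rw [h3]
  push_cast
  ring

end Summit.KontsevichZagierPeriods.Zeta5Search.RayH1
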